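import Mathlib

/-!
# The restricted union-row inequality of a RESISTANT obstruction is one PA fact times the total mass
(blind cell PercRepro2, mine-1 g46; MINE1-UNIONROW-K3.md §14.9.)

The obstruction `(X,Y) = ({u,v}, {u,w})`, `A = ↑{TTS, SST}`, `B = 7e3f1b0 = Γ ∖ ↓{TST, STS}` has no degree-3
avoidance-PA certificate on the full status grid (§10, exact Farkas dual) and no ray-restriction witness in any product-type
zero family (§14.8).  On the world of its `(v,S)`-family with `L = {σ_w ≠ T}` — the 12 cells with `σ_v ≠ S` and
`σ_w ≠ T` — the union-row form `V` is EXACTLY the total mass times the single positive-association fact of `{σ_w = S}`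
against `{σ_v ≠ T}` on `Γ` (`restricted_V_eq`), so the restricted inequality is a theorem of one fact
(`restricted_V_nonneg`): the obstruction of this instance lives entirely in the empty cells.  Cells are written `m<σ_u σ_v σ_w>`;
`V = Σ_{c ∉ D} m_c (Z·1_A(c) − M(A)) (Z·1_B(c) − M(B))` with `D = {σ_u = S, σ_w = T} ∪ {σ_v = S, σ_u = T} ∪ {σ_v = S, σ_w = T}`.
-/

namespace Summit.Ventures.PercRepro2.UnionRowResistantRestricted

set_option maxRecDepth 8000 in
/-- on the 12 cells with `σ_v ≠ S`, `σ_w ≠ T`: `V = Z · slack_Γ({σ_w = S}, {σ_v ≠ T})` -/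
theorem restricted_V_eq (mTTN mTTS mTNN mTNS mNTN mNTS mNNN mNNS mSTN mSTS mSNN mSNS : ℝ) :
    mTTN * (0 - (mTTS + mTNS + mNTS + mNNS + mSTS + mSNS)) * (0 - (mTNN + mTNS + mNNN + mNNS + mSNN + mSNS)) + mTTS * ((mTTN + mTTS + mTNN + mTNS + mNTN + mNTS + mNNN + mNNS + mSTN + mSTS + mSNN + mSNS) - (mTTS + mTNS + mNTS + mNNS + mSTS + mSNS)) * (0 - (mTNN + mTNS + mNNN + mNNS + mSNN + mSNS)) + mTNN * (0 - (mTTS + mTNS + mNTS + mNNS + mSTS + mSNS)) * ((mTTN + mTTS + mTNN + mTNS + mNTN + mNTS + mNNN + mNNS + mSTN + mSTS + mSNN + mSNS) - (mTNN + mTNS + mNNN + mNNS + mSNN + mSNS)) + mTNS * ((mTTN + mTTS + mTNN + mTNS + mNTN + mNTS + mNNN + mNNS + mSTN + mSTS + mSNN + mSNS) - (mTTS + mTNS + mNTS + mNNS + mSTS + mSNS)) * ((mTTN + mTTS + mTNN + mTNS + mNTN + mNTS + mNNN + mNNS + mSTN + mSTS + mSNN + mSNS) - (mTNN + mTNS +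 mNNN + mNNS + mSNN + mSNS)) + mNTN * (0 - (mTTS + mTNS + mNTS + mNNS + mSTS + mSNS)) * (0 - (mTNN + mTNS + mNNN + mNNS + mSNN + mSNS)) + mNTS * ((mTTN + mTTS + mTNN + mTNS + mNTN + mNTS + mNNN + mNNS + mSTN + mSTS + mSNN + mSNS) - (mTTS + mTNS + mNTS + mNNS + mSTS + mSNS)) * (0 - (mTNN + mTNS + mNNN + mNNS + mSNN + mSNS)) + mNNN * (0 - (mTTS + mTNS + mNTS + mNNS + mSTS + mSNS)) * ((mTTN + mTTS + mTNN + mTNS + mNTN + mNTS + mNNN + mNNS + mSTN + mSTS + mSNN + mSNS) - (mTNN + mTNS + mNNN + mNNS + mSNN + mSNS)) + mNNS * ((mTTN + mTTS + mTNN + mTNS + mNTN + mNTS + mNNN + mNNS + mSTN + mSTS + mSNN + mSNS) - (mTTS + mTNS + mNTS + mNNS + mSTS + mSNS)) * ((mTTN + mTTS + mTNN + mTNS + mNTN + mNTS + mNNN + mNNS + mSTN + mSTS + mSNN + mSNS) - (mTNN + mTNS + mNNN + mNNS + mSNN + mSNS)) + mSTN * (0 - (mTTS + mTNS + mNTS +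 mNNS + mSTS + mSNS)) * (0 - (mTNN + mTNS + mNNN + mNNS + mSNN + mSNS)) + mSTS * ((mTTN + mTTS + mTNN + mTNS + mNTN + mNTS + mNNN + mNNS + mSTN + mSTS + mSNN + mSNS) - (mTTS + mTNS + mNTS + mNNS + mSTS + mSNS)) * (0 - (mTNN + mTNS + mNNN + mNNS + mSNN + mSNS)) + mSNN * (0 - (mTTS + mTNS + mNTS + mNNS + mSTS + mSNS)) * ((mTTN + mTTS + mTNN + mTNS + mNTN + mNTS + mNNN + mNNS + mSTN + mSTS + mSNN + mSNS) - (mTNN + mTNS + mNNN + mNNS + mSNN + mSNS)) + mSNS * ((mTTN + mTTS + mTNN + mTNS + mNTN + mNTS + mNNN + mNNS + mSTN + mSTS + mSNN + mSNS) - (mTTS + mTNS + mNTS + mNNS + mSTS + mSNS)) * ((mTTN + mTTS + mTNN + mTNS + mNTN + mNTS + mNNN + mNNS + mSTN + mSTS + mSNN + mSNS) - (mTNN + mTNS + mNNN + mNNS + mSNN + mSNS))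
    = (mTTN + mTTS + mTNN + mTNS + mNTN + mNTS + mNNN + mNNS + mSTN + mSTS + mSNN + mSNS) * ((mTNS + mNNS + mSNS) * (mTTN + mTTS + mTNN + mTNS + mNTN + mNTS + mNNN + mNNS + mSTN + mSTS + mSNN + mSNS) - (mTTS + mTNS + mNTS + mNNS + mSTS + mSNS) * (mTNN + mTNS + mNNN + mNNS + mSNN + mSNS)) := by
  ring

/-- hence `V ≥ 0` on that world whenever the total mass is nonnegative and the one fact holds -/
theorem restricted_V_nonneg (mTTN mTTS mTNN mTNS mNTN mNTS mNNN mNNS mSTN mSTS mSNN mSNS : ℝ)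
    (hm : 0 ≤ (mTTN + mTTS + mTNN + mTNS + mNTN + mNTS + mNNN + mNNS + mSTN + mSTS + mSNN + mSNS))
    (hfact : 0 ≤ ((mTNS + mNNS + mSNS) * (mTTN + mTTS + mTNN + mTNS + mNTN + mNTS + mNNN + mNNS + mSTN + mSTS + mSNN + mSNS) - (mTTS + mTNS + mNTS + mNNS + mSTS + mSNS) * (mTNN + mTNS + mNNN + mNNS + mSNN + mSNS))) :
    0 ≤ mTTN * (0 - (mTTS + mTNS + mNTS + mNNS + mSTS + mSNS)) * (0 - (mTNN + mTNS + mNNN + mNNS + mSNN + mSNS)) + mTTS * ((mTTN + mTTS + mTNN + mTNS + mNTN + mNTS + mNNN + mNNS + mSTN + mSTS + mSNN + mSNS) - (mTTS + mTNS + mNTS + mNNS + mSTS + mSNS)) * (0 - (mTNN + mTNS + mNNN + mNNS + mSNN + mSNS)) + mTNN * (0 - (mTTS + mTNS + mNTS + mNNS + mSTS + mSNS)) * ((mTTN + mTTS + mTNN + mTNS + mNTN + mNTS + mNNN + mNNS + mSTN + mSTS + mSNN + mSNS) - (mTNN + mTNS + mNNN + mNNS + mSNN + mSNS)) + mTNS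 * ((mTTN + mTTS + mTNN + mTNS + mNTN + mNTS + mNNN + mNNS + mSTN + mSTS + mSNN + mSNS) - (mTTS + mTNS + mNTS + mNNS + mSTS + mSNS)) * ((mTTN + mTTS + mTNN + mTNS + mNTN + mNTS + mNNN + mNNS + mSTN + mSTS + mSNN + mSNS) - (mTNN + mTNS + mNNN + mNNS + mSNN + mSNS)) + mNTN * (0 - (mTTS + mTNS + mNTS + mNNS + mSTS + mSNS)) * (0 - (mTNN + mTNS + mNNN + mNNS + mSNN + mSNS)) + mNTS * ((mTTN + mTTS + mTNN + mTNS + mNTN + mNTS + mNNN + mNNS + mSTN + mSTS + mSNN + mSNS) - (mTTS + mTNS + mNTS + mNNS + mSTS + mSNS)) * (0 - (mTNN + mTNS + mNNN + mNNS + mSNN + mSNS)) + mNNN * (0 - (mTTS + mTNS + mNTS + mNNS + mSTS + mSNS)) * ((mTTN + mTTS + mTNN + mTNS + mNTN + mNTS + mNNN + mNNS + mSTN + mSTS + mSNN + mSNS) - (mTNN + mTNS + mNNN + mNNS + mSNN + mSNS)) + mNNS * ((mTTN + mTTS + mTNN + mTNS + mNTN + mNTS + mNNN + mNNS + mSTN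 + mSTS + mSNN + mSNS) - (mTTS + mTNS + mNTS + mNNS + mSTS + mSNS)) * ((mTTN + mTTS + mTNN + mTNS + mNTN + mNTS + mNNN + mNNS + mSTN + mSTS + mSNN + mSNS) - (mTNN + mTNS + mNNN + mNNS + mSNN + mSNS)) + mSTN * (0 - (mTTS + mTNS + mNTS + mNNS + mSTS + mSNS)) * (0 - (mTNN + mTNS + mNNN + mNNS + mSNN + mSNS)) + mSTS * ((mTTN + mTTS + mTNN + mTNS + mNTN + mNTS + mNNN + mNNS + mSTN + mSTS + mSNN + mSNS) - (mTTS + mTNS + mNTS + mNNS + mSTS + mSNS)) * (0 - (mTNN + mTNS + mNNN + mNNS + mSNN + mSNS)) + mSNN * (0 - (mTTS + mTNS + mNTS + mNNS + mSTS + mSNS)) * ((mTTN + mTTS + mTNN + mTNS + mNTN + mNTS + mNNN + mNNS + mSTN + mSTS + mSNN + mSNS) - (mTNN + mTNS + mNNN + mNNS + mSNN + mSNS)) + mSNS * ((mTTN + mTTS + mTNN + mTNS + mNTN + mNTS + mNNN + mNNS + mSTN + mSTS + mSNN + mSNS) - (mTTS + mTNS + mNTS + mNNS + mSTS + mSNS))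 * ((mTTN + mTTS + mTNN + mTNS + mNTN + mNTS + mNNN + mNNS + mSTN + mSTS + mSNN + mSNS) - (mTNN + mTNS + mNNN + mNNS + mSNN + mSNS)) := by
  rw [restricted_V_eq]
  exact mul_nonneg hm hfact

end Summit.Ventures.PercRepro2.UnionRowResistantRestricted
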